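import Literature.NumberTheory.EllipticCurves.PAdicMeasureMoments
import Mathlib.NumberTheory.Padics.Complex
import Mathlib.Analysis.Normed.Module.FiniteDimension
import HarnessLib

/-!
# The `p`-adic Mellin transform of a bounded distribution with values in a finite extension of
# `ℚ_p` inside `ℚ̄_p` (Mazur–Tate–Teitelbaum 1986, §I.11–I.13, coefficients in `ℚ̄_p`)

Topic `Literature/NumberTheory/EllipticCurves`, namespace `Literature.NumberTheory.EllipticCurves`.

`PAdicMeasureTransform` / `PAdicMeasureMoments` attach to a bounded `ℚ_p`-VALUED distribution
`μ` on `ℤ_p` (a family `μ n : ℤ/pⁿ → ℚ_p` with the distribution relation and `‖μ‖ ≤ C`) the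
bounded power series `L_μ(T) = ∫_{ℤ_p^×} (1 + T)^{ℓ(x)} dμ(x) ∈ ℚ_p⟦T⟧` and evaluate it at the
points `T = χ(γ) − 1` of the even `p`-power-order Dirichlet characters
(`exists_powerSeries_of_bounded_distribution'`).  The modular-symbol measure of a newform `g`
whose coefficient field `K_g` does not embed in `ℚ_p` takes values in the finite extension
`ℚ_p(ι K_g, υ) ⊂ ℚ̄_p` (Mazur–Tate–Teitelbaum 1986, §I.10: "`μ_{f,α}` takes values in
`(1/α^∞) 𝒪_f Ω^±`"; Emerton–Pollack–Weston 2006, §3.1: `K` "the finite extension of `ℚ_p`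
generated by the Fourier coefficients").  This file transports the `ℚ_p`-engine to distributions
with values in a FINITE-DIMENSIONAL intermediate field `F` of `ℚ̄_p/ℚ_p`
(`exists_powerSeries_of_bounded_distribution_algCl`): choose a `ℚ_p`-basis `(b_i)` of `F`, apply
the engine to the (bounded, by continuity of the coordinate functionals on the finite-dimensional
normed space `F`) coordinate distributions `μ_i`, and recombine `L = ∑_i b_i L_{μ_i} ∈ ℚ̄_p⟦T⟧`;
the transform has bounded coefficients in `F`, constant term `μ(ℤ_p) − μ(pℤ_p) = μ(ℤ_p^×)`, and
`L(χ(γ) − 1) = ∑_{a mod p^{m+1}} χ(a) μ(a + p^{m+1}ℤ_p)` in `ℂ_p`.  Everything is proved; there are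
no named facts.  Consumer: the cyclotomic `p`-adic `L`-function of an ordinary newform of weight
`k` with `ℚ̄_p`-coefficients (`CyclotomicPAdicLFunctionWeightK`, the named fact
`exists_isCycPAdicLFunctionWeightK` of the BSD residual cell's X11a chain).

References: B. Mazur, J. Tate, J. Teitelbaum, *On `p`-adic analogues of the conjectures of Birch
and Swinnerton-Dyer*, Invent. Math. 84 (1986), §I.10–I.13; M. Emerton, R. Pollack, T. Weston,
Invent. Math. 163 (2006), §3.1; L. Washington, *Introduction to cyclotomic fields*, GTM 83, §12.2
(measures and power series).
-/

noncomputable section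

open Filter Topology

namespace Literature.NumberTheory.EllipticCurves

variable {p : ℕ} [Fact p.Prime]

/-! ### Coordinates of a distribution with values in a finite-dimensional `F ⊆ ℚ̄_p` -/

section Coordinates

variable {F : IntermediateField ℚ_[p] (PadicAlgCl p)}

/-- The norm of `F ⊆ ℚ̄_p` is the restriction of the norm of `ℚ̄_p`. [folklore]
[cite: MazurTateTeitelbaum1986Invent, §I.11] -/
theorem IntermediateField.norm_coe_padicAlgCl (x : F) : ‖(x : PadicAlgCl p)‖ = ‖x‖ := rfl

/-- **The coordinate functionals of a finite-dimensional `F ⊆ ℚ̄_p` are bounded**: for a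
`ℚ_p`-basis `b` of `F` there is `K ≥ 0` with `‖b.coord i x‖ ≤ K ‖x‖` for all `i`, `x` (linear maps
on a finite-dimensional normed space over the complete field `ℚ_p` are continuous).
[cite: MazurTateTeitelbaum1986Invent, §I.11] -/
theorem exists_norm_coord_le [FiniteDimensional ℚ_[p] F] {ι : Type*} [Fintype ι]
    (b : Module.Basis ι ℚ_[p] F) :
    ∃ K : ℝ, 0 ≤ K ∧ ∀ (i : ι) (x : F), ‖b.coord i x‖ ≤ K * ‖x‖ := by
  classical
  have h : ∀ i : ι, ∃ K : ℝ, 0 < K ∧ ∀ x : F, ‖b.coord i x‖ ≤ K * ‖x‖ := fun i ↦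
    SemilinearMapClass.bound_of_continuous (b.coord i) (b.coord i).continuous_of_finiteDimensional
  choose K hK0 hK using h
  refine ⟨∑ i, K i, Finset.sum_nonneg fun i _ ↦ (hK0 i).le, fun i x ↦ (hK i x).trans ?_⟩
  exact mul_le_mul_of_nonneg_right
    (Finset.single_le_sum (f := K) (fun j _ ↦ (hK0 j).le) (Finset.mem_univ i)) (norm_nonneg _)

/-- **Reconstruction from coordinates in `ℚ̄_p`**: `x = ∑_i (b.coord i x) · b_i` as elements of
`ℚ̄_p`. [folklore] [cite: MazurTateTeitelbaum1986Invent, §I.11] -/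
theorem sum_coord_mul_coe_eq {ι : Type*} [Fintype ι] (b : Module.Basis ι ℚ_[p] F) (x : F) :
    ∑ i, algebraMap ℚ_[p] (PadicAlgCl p) (b.coord i x) * (b i : PadicAlgCl p) = (x : PadicAlgCl p) := by
  conv_rhs => rw [← b.sum_repr x]
  rw [IntermediateField.coe_sum]
  refine Finset.sum_congr rfl fun i _ ↦ ?_
  rw [IntermediateField.coe_smul, Algebra.smul_def, Module.Basis.coord_apply]

end Coordinates

/-! ### The transform of an `F`-valued bounded distribution -/

section Transform

/-- **The `p`-adic Mellin transform of a bounded distribution with values in a finite extension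
`F` of `ℚ_p` inside `ℚ̄_p`** (Mazur–Tate–Teitelbaum 1986, §I.11–I.13 for `𝒪_f`-valued measures;
Washington §12.2): if `μ = (μ n : ℤ/pⁿ → ℚ̄_p)` takes values in `F`, `[F : ℚ_p] < ∞`, satisfies the
distribution relation `∑_{b ≡ a (pⁿ)} μ(b + p^{n+1}ℤ_p) = μ(a + pⁿℤ_p)` and `‖μ‖ ≤ C`, then there is
`L ∈ ℚ̄_p⟦T⟧` — `L(T) = ∫_{ℤ_p^×} (1 + T)^{ℓ(x)} dμ(x)`, `γ = 1 + p^{e₀}` — with bounded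
coefficients in `F`, constant term `L(0) = μ(ℤ_p) − μ(pℤ_p)` (`= μ(ℤ_p^×)`), and, for every `m` and
every even Dirichlet character `χ` mod `p^{m+1}` of `p`-power order with values in `ℂ_p`,
`∑_k [T^k]L · (χ(γ) − 1)^k = ∑_{a mod p^{m+1}} χ(a) μ(a + p^{m+1}ℤ_p)` in `ℂ_p`.  Proof: coordinates
with respect to a `ℚ_p`-basis of `F` (bounded: `exists_norm_coord_le`), the `ℚ_p`-engine
`exists_powerSeries_of_bounded_distribution'` for each coordinate, and recombination.
[cite: MazurTateTeitelbaum1986Invent, §I.11–I.13] [cite: Washington1997, §12.2] -/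
theorem exists_powerSeries_of_bounded_distribution_algCl
    {F : IntermediateField ℚ_[p] (PadicAlgCl p)} [FiniteDimensional ℚ_[p] F]
    {μ : (n : ℕ) → ZMod (p ^ n) → PadicAlgCl p} (hμF : ∀ (n : ℕ) (a : ZMod (p ^ n)), μ n a ∈ F)
    (hdist : ∀ (n : ℕ) (a : ZMod (p ^ n)),
      ∑ b ∈ Finset.univ.filter (fun b : ZMod (p ^ (n + 1)) ↦
        ZMod.castHom (pow_dvd_pow p n.le_succ) (ZMod (p ^ n)) b = a), μ (n + 1) b = μ n a)
    {C : ℝ} (hC : ∀ (n : ℕ) (a : ZMod (p ^ n)), ‖μ n a‖ ≤ C) :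
    ∃ L : PowerSeries (PadicAlgCl p),
      (∃ C' : ℝ, ∀ k : ℕ, ‖PowerSeries.coeff k L‖ ≤ C') ∧
      (∀ k : ℕ, PowerSeries.coeff k L ∈ F) ∧
      PowerSeries.constantCoeff L = μ 0 0 - μ 1 0 ∧
      ∀ (m : ℕ) (χ : DirichletCharacter ℂ_[p] (p ^ (m + 1))), χ.Even →
        (∃ j : ℕ, orderOf χ = p ^ j) →
          HasSum (fun k : ℕ ↦ algebraMap (PadicAlgCl p) ℂ_[p] (PowerSeries.coeff k L) *
              (χ (cyclotomicGenerator p : ZMod (p ^ (m + 1))) - 1) ^ k)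
            (∑ a : ZMod (p ^ (m + 1)), χ a * algebraMap (PadicAlgCl p) ℂ_[p] (μ (m + 1) a)) := by
  classical
  -- ### coordinates
  set b := Module.finBasis ℚ_[p] F with hb
  set μF : (n : ℕ) → ZMod (p ^ n) → F := fun n a ↦ ⟨μ n a, hμF n a⟩ with hμF_def
  set ν : Fin (Module.finrank ℚ_[p] F) → (n : ℕ) → ZMod (p ^ n) → ℚ_[p] :=
    fun i n a ↦ b.coord i (μF n a) with hν
  have hrec : ∀ (n : ℕ) (a : ZMod (p ^ n)),
      ∑ i, algebraMap ℚ_[p] (PadicAlgCl p) (ν i n a) * (b i : PadicAlgCl p) = μ n a :=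
    fun n a ↦ sum_coord_mul_coe_eq b (μF n a)
  -- distribution relation of the coordinates
  have hdistF : ∀ (n : ℕ) (a : ZMod (p ^ n)),
      ∑ c ∈ Finset.univ.filter (fun c : ZMod (p ^ (n + 1)) ↦
        ZMod.castHom (pow_dvd_pow p n.le_succ) (ZMod (p ^ n)) c = a), μF (n + 1) c = μF n a := by
    intro n a
    apply Subtype.ext
    rw [AddSubmonoidClass.coe_finsetSum]
    exact hdist n a
  have hνdist : ∀ (i) (n : ℕ) (a : ZMod (p ^ n)),
      ∑ c ∈ Finset.univ.filter (fun c : ZMod (p ^ (n + 1)) ↦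
        ZMod.castHom (pow_dvd_pow p n.le_succ) (ZMod (p ^ n)) c = a), ν i (n + 1) c = ν i n a := by
    intro i n a
    simp only [hν]
    rw [← map_sum, hdistF n a]
  -- boundedness of the coordinates
  obtain ⟨K, hK0, hK⟩ := exists_norm_coord_le b
  have hνC : ∀ (i) (n : ℕ) (a : ZMod (p ^ n)), ‖ν i n a‖ ≤ K * C := by
    intro i n a
    refine (hK i (μF n a)).trans (mul_le_mul_of_nonneg_left ?_ hK0)
    rw [← IntermediateField.norm_coe_padicAlgCl]
    exact hC n a
  -- ### the engine, coordinatewise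
  have heng := fun i ↦ exists_powerSeries_of_bounded_distribution' (hνdist i) (hνC i)
  choose Lc hLcC _hLcT hLc0 hLcχ using heng
  -- ### recombination
  refine ⟨∑ i, PowerSeries.C (b i : PadicAlgCl p) *
      PowerSeries.map (algebraMap ℚ_[p] (PadicAlgCl p)) (Lc i), ?_, ?_, ?_, ?_⟩
  · -- bounded coefficients
    refine ⟨∑ i : Fin (Module.finrank ℚ_[p] F), ‖(b i : PadicAlgCl p)‖ * (K * C), fun k ↦ ?_⟩
    rw [map_sum]
    refine (norm_sum_le _ _).trans (Finset.sum_le_sum fun i _ ↦ ?_)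
    rw [PowerSeries.coeff_C_mul, PowerSeries.coeff_map, norm_mul]
    refine mul_le_mul_of_nonneg_left ?_ (norm_nonneg _)
    rw [norm_algebraMap']
    exact hLcC i k
  · -- coefficients in `F`
    intro k
    rw [map_sum]
    refine sum_mem fun i _ ↦ ?_
    rw [PowerSeries.coeff_C_mul, PowerSeries.coeff_map]
    exact mul_mem (b i).2 (IntermediateField.algebraMap_mem F _)
  · -- constant term `μ(ℤ_p) − μ(pℤ_p)`
    haveI : NeZero (p ^ cyclotomicExponent p) := ⟨pow_ne_zero _ (Fact.out : p.Prime).ne_zero⟩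
    have he : 1 ≤ cyclotomicExponent p := by
      rw [cyclotomicExponent]; split_ifs <;> omega
    have hunits : ∀ i, ∑ u : (ZMod (p ^ cyclotomicExponent p))ˣ, ν i (cyclotomicExponent p) u =
        ν i 0 0 - ν i 1 0 := by
      intro i
      rw [sum_units_eq_sum_filter_isUnit (F := fun a ↦ ν i (cyclotomicExponent p) a),
        eq_sub_iff_add_eq, ← sum_filter_not_isUnit_eq_of_distribution (hνdist i) he,
        Finset.sum_filter_add_sum_filter_not, sum_level_eq_of_distribution (hνdist i)]
    rw [← PowerSeries.coeff_zero_eq_constantCoeff_apply, map_sum]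
    simp_rw [PowerSeries.coeff_C_mul, PowerSeries.coeff_map, PowerSeries.coeff_zero_eq_constantCoeff_apply,
      hLc0, hunits, map_sub, mul_sub, Finset.sum_sub_distrib]
    rw [← hrec 0 0, ← hrec 1 0]
    congr 1 <;> exact Finset.sum_congr rfl fun i _ ↦ mul_comm _ _
  · -- evaluation at `χ(γ) − 1`
    intro m χ heven hord
    have key := hasSum_sum (s := Finset.univ) fun i (_ : i ∈ Finset.univ) ↦
      (hLcχ i m χ heven hord).mul_left (algebraMap (PadicAlgCl p) ℂ_[p] (b i : PadicAlgCl p))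
    have hfun : (fun k : ℕ ↦ algebraMap (PadicAlgCl p) ℂ_[p] (PowerSeries.coeff k
        (∑ i, PowerSeries.C (b i : PadicAlgCl p) *
          PowerSeries.map (algebraMap ℚ_[p] (PadicAlgCl p)) (Lc i))) *
        (χ (cyclotomicGenerator p : ZMod (p ^ (m + 1))) - 1) ^ k) =
        fun k : ℕ ↦ ∑ i ∈ Finset.univ, algebraMap (PadicAlgCl p) ℂ_[p] (b i : PadicAlgCl p) *
          (algebraMap ℚ_[p] ℂ_[p] (PowerSeries.coeff k (Lc i)) *
            (χ (cyclotomicGenerator p : ZMod (p ^ (m + 1))) - 1) ^ k) := by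
      funext k
      rw [map_sum, map_sum, Finset.sum_mul]
      refine Finset.sum_congr rfl fun i _ ↦ ?_
      rw [PowerSeries.coeff_C_mul, PowerSeries.coeff_map, map_mul,
        ← IsScalarTower.algebraMap_apply ℚ_[p] (PadicAlgCl p) ℂ_[p]]
      ring
    have hval : ∑ a : ZMod (p ^ (m + 1)), χ a * algebraMap (PadicAlgCl p) ℂ_[p] (μ (m + 1) a) =
        ∑ i ∈ Finset.univ, algebraMap (PadicAlgCl p) ℂ_[p] (b i : PadicAlgCl p) *
          ∑ a : ZMod (p ^ (m + 1)), χ a * algebraMap ℚ_[p] ℂ_[p] (ν i (m + 1) a) := by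
      simp_rw [Finset.mul_sum]
      rw [Finset.sum_comm]
      refine Finset.sum_congr rfl fun a _ ↦ ?_
      rw [← hrec (m + 1) a, map_sum, Finset.mul_sum]
      refine Finset.sum_congr rfl fun i _ ↦ ?_
      rw [map_mul, ← IsScalarTower.algebraMap_apply ℚ_[p] (PadicAlgCl p) ℂ_[p]]
      ring
    rw [hfun, hval]
    exact key

end Transform

end Literature.NumberTheory.EllipticCurves

end
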